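/-
Copyright: literature anchor (record-only). Source: G. Blekherman, P. A. Parrilo, R. R. Thomas
(eds.), *Semidefinite Optimization and Convex Algebraic Geometry*, MOS-SIAM Series on
Optimization 13, SIAM 2012, Chapter 7 (J. Gouveia and R. R. Thomas, *Convex hulls of algebraic
sets*), §7.3.2 Lemma 7.27 (p. 318) and §7.3.3 Corollaries 7.45 and 7.49 (pp. 326–327).
-/
import Mathlib
import Literature.Algebra.Polynomial.ThetaBodies
import Literature.Algebra.Polynomial.ThetaBodiesSingularities
import Literature.Algebra.Polynomial.FiniteRankMomentMatrix

/-!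
# Theta bodies: singularities obstruct finite convergence (BPT Corollaries 7.45 and 7.49)

[cite: BlekhermanParriloThomas2012, Ch. 7 §7.3.2 Lemma 7.27 p. 318; §7.3.3 Corollaries 7.45,
7.49, pp. 326–327]

Lemma 7.27 of the book (quoted from Gouveia–Parrilo–Thomas, *Theta bodies for polynomial
ideals*, SIAM J. Optim. 2010, without proof) says: if `I ⊆ ℝ[x]` is real radical, an affine
inequality `l ≥ 0` is valid on `TH_k(I)` iff `l` is `k`-sos modulo `I`.  The "if" direction is
the definition of `TH_k(I)`; the "only if" direction is recorded here as the NAMED FACT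
`ValidIffKSos` (a `Prop`, used as a hypothesis, not an axiom).

Conditional on it we derive the two printed obstructions to finite convergence of the theta
body hierarchy of a real radical ideal `I` with a valid affine inequality `l ≥ 0` on `V_ℝ(I)`:

* `not_isThetaExact_of_forall_not_isKSosMod` — the common core: if `l` is not `k`-sos mod `I`
  for any `k`, then `I` is not `TH_k`-exact for any `k`;
* **Corollary 7.45** `not_isThetaExact_of_not_mem_idealNormalSpace` — `l(P) = 0` at a point
  `P ∈ V_ℝ(I)` with `∇l ∉ N_P(I)` (via Proposition 7.44,
  `ThetaBodiesSingularities.not_isKSosMod_affinePoly`);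
* **Corollary 7.49** `not_isThetaExact_of_coeff_neg` — an algebra map
  `ψ : ℝ[x] → ℝ[t]` with `ψ(I) ⊆ ⟨tⁿ⟩` under which `ψ(l)` has negative leading (lowest)
  coefficient below degree `n` (via Theorem 7.48,
  `ThetaBodiesSingularities.not_isKSosMod_of_coeff_neg`);
* the bifolium of Example 7.46/7.50 is therefore not `TH_k`-exact for any `k` *provided*
  `⟨p⟩` is real radical (`not_isThetaExact_bifolium_of_isRealRadical`; real-radicality of
  `⟨p⟩` is asserted in the book and not formalised here).
-/

open MvPolynomial
open Literature.Algebra.Polynomial.ThetaBodies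
open Literature.Algebra.Polynomial.ThetaBodiesSingularities
open Literature.Algebra.Polynomial.FiniteRankMomentMatrix (IsRealRadical)

namespace Literature.Algebra.Polynomial.ThetaBodiesExactnessObstruction

/-- NAMED FACT (BPT Lemma 7.27, the non-definitional direction; Gouveia–Parrilo–Thomas 2010):
for a real radical ideal `I ⊆ ℝ[x₁,…,xₙ]`, every affine inequality `α + ⟨a,x⟩ ≥ 0` valid on
`TH_k(I)` is `k`-sos modulo `I`.  Stated for the index types `Fin n`; used as a hypothesis.
[cite: BlekhermanParriloThomas2012, Ch. 7 §7.3.2, Lemma 7.27, p. 318] -/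
def ValidIffKSos : Prop :=
  ∀ (n k : ℕ) (I : Ideal (MvPolynomial (Fin n) ℝ)), IsRealRadical I →
    ∀ (α : ℝ) (a : Fin n → ℝ), (∀ x ∈ thetaBody I k, 0 ≤ α + a ⬝ᵥ x) →
      IsKSosMod I k (affinePoly α a)

/-- The closed half-space `{x | 0 ≤ α + ⟨a,x⟩}` is convex.
[cite: BlekhermanParriloThomas2012, Ch. 7 §7.3.3, proof of Corollary 7.45, p. 326] -/
theorem convex_affineHalfSpace {n : ℕ} (α : ℝ) (a : Fin n → ℝ) :
    Convex ℝ {x : Fin n → ℝ | 0 ≤ α + a ⬝ᵥ x} := by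
  have heq : {x : Fin n → ℝ | 0 ≤ α + a ⬝ᵥ x} = {x : Fin n → ℝ | -α ≤ a ⬝ᵥ x} :=
    Set.ext fun x => ⟨fun hx => by simp only [Set.mem_setOf_eq] at hx ⊢; linarith,
      fun hx => by simp only [Set.mem_setOf_eq] at hx ⊢; linarith⟩
  rw [heq]
  exact convex_halfSpace_ge (𝕜 := ℝ) (f := fun x : Fin n → ℝ => a ⬝ᵥ x)
    ⟨fun x y => dotProduct_add a x y, fun c x => dotProduct_smul c a x⟩ (-α)

/-- The closed half-space `{x | 0 ≤ α + ⟨a,x⟩}` is closed.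
[cite: BlekhermanParriloThomas2012, Ch. 7 §7.3.3, proof of Corollary 7.45, p. 326] -/
theorem isClosed_affineHalfSpace {n : ℕ} (α : ℝ) (a : Fin n → ℝ) :
    IsClosed {x : Fin n → ℝ | 0 ≤ α + a ⬝ᵥ x} :=
  isClosed_le continuous_const (continuous_const.add (continuous_finsetSum _ fun i _ =>
    continuous_const.mul (continuous_apply i)))

/-- An affine inequality valid on `V_ℝ(I)` is valid on `cl(conv(V_ℝ(I)))`.
[cite: BlekhermanParriloThomas2012, Ch. 7 §7.3.3, proof of Corollary 7.45, p. 326] -/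
theorem closure_convexHull_zeroLocus_subset_affineHalfSpace {n : ℕ}
    (I : Ideal (MvPolynomial (Fin n) ℝ)) {α : ℝ} {a : Fin n → ℝ}
    (hvalid : ∀ x ∈ zeroLocus ℝ I, 0 ≤ α + a ⬝ᵥ x) :
    closure (convexHull ℝ (zeroLocus ℝ I)) ⊆ {x : Fin n → ℝ | 0 ≤ α + a ⬝ᵥ x} :=
  closure_minimal (convexHull_min (fun x hx => hvalid x hx) (convex_affineHalfSpace α a))
    (isClosed_affineHalfSpace α a)

/-- Common core of Corollaries 7.45 and 7.49 (conditional on Lemma 7.27): if `I` is real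
radical, `l = α + ⟨a,x⟩ ≥ 0` is valid on `V_ℝ(I)` and `l` is not `k`-sos modulo `I` for any
`k`, then `I` is not `TH_k`-exact for any `k`.
[cite: BlekhermanParriloThomas2012, Ch. 7 §7.3.3, Corollaries 7.45 and 7.49, pp. 326–327] -/
theorem not_isThetaExact_of_forall_not_isKSosMod (h : ValidIffKSos) {n : ℕ}
    {I : Ideal (MvPolynomial (Fin n) ℝ)} (hI : IsRealRadical I) {α : ℝ} {a : Fin n → ℝ}
    (hvalid : ∀ x ∈ zeroLocus ℝ I, 0 ≤ α + a ⬝ᵥ x)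
    (hnot : ∀ k, ¬ IsKSosMod I k (affinePoly α a)) (k : ℕ) : ¬ IsThetaExact I k := by
  intro hex
  refine hnot k (h n k I hI α a fun x hx => ?_)
  have hex' : thetaBody I k = closure (convexHull ℝ (zeroLocus ℝ I)) := hex
  rw [hex'] at hx
  exact closure_convexHull_zeroLocus_subset_affineHalfSpace I hvalid hx

/-- **Corollary 7.45** (conditional on Lemma 7.27). If `I` is real radical and `l ≥ 0` is an
affine inequality valid on `V_ℝ(I)` with `l(P) = 0` at a point `P ∈ V_ℝ(I)` such that
`∇l ∉ N_P(I)`, then `I` is not `TH_k`-exact for any `k`.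
[cite: BlekhermanParriloThomas2012, Ch. 7 §7.3.3, Corollary 7.45, p. 326] -/
theorem not_isThetaExact_of_not_mem_idealNormalSpace (h : ValidIffKSos) {n : ℕ}
    {I : Ideal (MvPolynomial (Fin n) ℝ)} (hI : IsRealRadical I) {P : Fin n → ℝ}
    (hP : P ∈ zeroLocus ℝ I) {α : ℝ} {a : Fin n → ℝ}
    (hvalid : ∀ x ∈ zeroLocus ℝ I, 0 ≤ α + a ⬝ᵥ x) (hl : α + a ⬝ᵥ P = 0)
    (ha : a ∉ idealNormalSpace I P) (k : ℕ) : ¬ IsThetaExact I k :=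
  not_isThetaExact_of_forall_not_isKSosMod h hI hvalid (not_isKSosMod_affinePoly hP hl ha) k

/-- **Corollary 7.49** (conditional on Lemma 7.27). If `I` is real radical, `l ≥ 0` is an affine
inequality valid on `V_ℝ(I)`, and there is an `ℝ`-algebra map `ψ : ℝ[x] → ℝ[t]` with
`ψ(I) ⊆ ⟨tⁿ⟩` (i.e. a homomorphism `ℝ[x]/I → ℝ[t]/⟨tⁿ⟩`) for which `ψ(l)` has a negative
lowest coefficient in degree `i < n`, then `I` is not `TH_k`-exact for any `k`.
[cite: BlekhermanParriloThomas2012, Ch. 7 §7.3.3, Corollary 7.49, p. 327] -/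
theorem not_isThetaExact_of_coeff_neg (h : ValidIffKSos) {n : ℕ}
    {I : Ideal (MvPolynomial (Fin n) ℝ)} (hI : IsRealRadical I) {α : ℝ} {a : Fin n → ℝ}
    (hvalid : ∀ x ∈ zeroLocus ℝ I, 0 ≤ α + a ⬝ᵥ x)
    (ψ : MvPolynomial (Fin n) ℝ →ₐ[ℝ] Polynomial ℝ) {m : ℕ}
    (hψ : ∀ g ∈ I, Polynomial.X ^ m ∣ ψ g) {i : ℕ} (hi : i < m)
    (hlead : ∀ j < i, (ψ (affinePoly α a)).coeff j = 0)
    (hneg : (ψ (affinePoly α a)).coeff i < 0) (k : ℕ) : ¬ IsThetaExact I k :=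
  not_isThetaExact_of_forall_not_isKSosMod h hI hvalid
    (not_isKSosMod_of_coeff_neg ψ hψ hi hlead hneg) k

/-- Examples 7.46/7.50 concluded (conditional on Lemma 7.27 and on real-radicality of `⟨p⟩`,
both taken as hypotheses): the bifolium ideal `⟨(x²+y²)² - (x+5y)x²⟩` is not `TH_k`-exact for
any `k`, since `x + 5y ≥ 0` is valid on the curve and `x + 5y` is never `k`-sos modulo `⟨p⟩`.
[cite: BlekhermanParriloThomas2012, Ch. 7 §7.3.3, Examples 7.46 and 7.50, pp. 326–327] -/
theorem not_isThetaExact_bifolium_of_isRealRadical (h : ValidIffKSos)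
    (hI : IsRealRadical (Ideal.span {bifolium})) (k : ℕ) :
    ¬ IsThetaExact (Ideal.span {bifolium}) k := by
  refine not_isThetaExact_of_forall_not_isKSosMod h hI (α := 0) (a := ![1, 5])
    (fun x hx => ?_) (fun k => ?_) k
  · have hx' := add_five_mul_nonneg_of_mem_zeroLocus hx
    simpa [dotProduct, Fin.sum_univ_two] using hx'
  · have hA : affinePoly 0 ![1, 5] = (X 0 + 5 * X 1 : MvPolynomial (Fin 2) ℝ) := by
      simp only [affinePoly, map_zero, zero_add, Fin.sum_univ_two, Matrix.cons_val_zero,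
        Matrix.cons_val_one, map_one, one_mul]
      rw [show (C 5 : MvPolynomial (Fin 2) ℝ) = 5 from map_ofNat C 5]
    rw [hA]
    exact not_isKSosMod_bifolium k

end Literature.Algebra.Polynomial.ThetaBodiesExactnessObstruction
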